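import Mathlib
import HarnessLib
import Summits.ResolutionOfSingularities.ResolutionOfSingularities.Theorems.WildQuotientsWildQuotientResolutionS1aMemberAwaySections

/-!
# S1a — R4c cusp, brick (b3′-sections, two units): THE MEMBER ON `D(b)` PRESENTED BY SECTIONS with SEPARATE degree-0 normalisers (`exists_memberSections_away₂`)

[OURS · L1 W4.5c · lead-1 g17; plan-1 RULING R-F15v (2) ★ R4c `cusp_killsIn_two`, memo `Cruxes/CyclicQuotientFourfolds/Lines/s1a_logminvertex-R4c-PROGRESS.md` §2/§4 (b3′):
second half of the GraphTailMember pattern on the LOCALISED member chart of ✓`exists_principalCentreChartSec_of_memberAway`: given moreover a homogeneous UNIT `u` of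
the localised model for EACH generator (`θ₀ = e₀•θ_{u₀}`, `θ₁ = e₁•θ_{u₁}`; on `U_O`: `u₀ = X₂′, e₀ = 3` so that `a·(π^*x₂)³ = π^*x₀`, and `u₁ = X₁′, e₁ = 3` so that `b·(π^*x₁)³ = π^*f`), the member
generators have DEGREE-0 ASSOCIATES `a = x′₀·u^{−e₀}`, `b = φ·u^{−e₁}` (✓`CoarseChart.exists_inv_pow_mem_of_isUnit`), honest sections of `D(b)`, and the principal-centre
chart filtration is the weighted filtration of `(a : 2, b : 1)` on every affine `U ≤ D(b)` (✓`CoarseChart.filtration_eq_weightedFiltration_sections`) — the form consumed by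
✓`killsIn_one_of_sectionCharts`; the Veronese degree is produced inside (✓`exists_veroneseNormalised_memberAway`)] — NOT statements of the manuscript; counted 0; AI-level
work, weaker than expert review. Crux stmt-ResolutionOfSingularities-17941 `CyclicQuotientFourfolds`, line `s1a-logminvertex` v13 (`stub_reachLowerInFX`).
-/

set_option linter.dupNamespace false

noncomputable section

open CategoryTheory Limits AlgebraicGeometry TopologicalSpace Topology Opposite MvPolynomial
open Literature.AlgebraicGeometry.Resolution Literature.AlgebraicGeometry.RelativeSpec
open scoped LaurentPolynomial
open Summit.ResolutionOfSingularities.ResolutionOfSingularities.Theorems.WildQuotientResolution.S1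
open Summit.ResolutionOfSingularities.ResolutionOfSingularities.Theorems.WildQuotientResolution.S1.NodeAtlas
open Summit.ResolutionOfSingularities.ResolutionOfSingularities.Theorems.WildQuotientResolution.S1.ProducerStep
open Summit.ResolutionOfSingularities.ResolutionOfSingularities.Theorems.WildQuotientResolution.S1.CoarseChart
open Summit.ResolutionOfSingularities.ResolutionOfSingularities.Theorems.WildQuotientResolution.S1.NodeTransport
open Summit.ResolutionOfSingularities.ResolutionOfSingularities.Theorems.WildQuotientResolution.S1.KillCert
open Summit.ResolutionOfSingularities.ResolutionOfSingularities.Theorems.WildQuotientResolution.S1.BlowupCharts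
open Summit.ResolutionOfSingularities.ResolutionOfSingularities.Theorems.WildQuotientResolution.S1.NpFrame
open Summit.ResolutionOfSingularities.ResolutionOfSingularities.Theorems.WildQuotientResolution.S1.NodeAway
open Summit.ResolutionOfSingularities.ResolutionOfSingularities.Theorems.WildQuotientResolution.S1.FreeModel
open Summit.ResolutionOfSingularities.ResolutionOfSingularities.Theorems.WildQuotientResolution.S1.GoodCharts
open Summit.ResolutionOfSingularities.ResolutionOfSingularities.Theorems.WildQuotientResolution.S1.GameFrame.GModel

namespace Summit.ResolutionOfSingularities.ResolutionOfSingularities.Theorems.WildQuotientResolution.S1.GameFrame.GModel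

variable {p : ℕ} {X' X₁ : Scheme.{0}} {q : X' ⟶ X₁} {G : Type} [Group G] {ρ : G →* Aut X'} {g₀ : G}

section MemberAway

variable {k : Type} [Field k] (hG : ∀ g : G, g ∈ Subgroup.zpowers g₀) (M : GModel p q G ρ g₀) (W : M.act.StableAffineOpens) (DW : NodeData p M.act g₀ W)
  (qd b' : (MvPolynomial (Option (Fin 4)) k)) (Φ : letI := DW.instCommRing; letI := DW.instGradedRing; DW.B ≃+* Localization.Away qd) (b : Γ(M.V, W.1))
  (hσb : letI := DW.instCommRing; letI := DW.instGradedRing; DW.σ ((DW.e b : ↥(DW.𝒜 0)) : DW.B) = ((DW.e b : ↥(DW.𝒜 0)) : DW.B))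
  (Φ' : letI := DW.instCommRing; letI := DW.instGradedRing; (Localization.Away ((DW.e b : ↥(DW.𝒜 0)) : DW.B)) ≃+* Localization.Away (qd * b'))
  (hpin : letI := DW.instCommRing; letI := DW.instGradedRing; ∀ a : (MvPolynomial (Option (Fin 4)) k), Φ' (algebraMap DW.B (Localization.Away ((DW.e b : ↥(DW.𝒜 0)) : DW.B)) (Φ.symm ((algebraMap (MvPolynomial (Option (Fin 4)) k) (Localization.Away qd)) a))) = (algebraMap (MvPolynomial (Option (Fin 4)) k) (Localization.Away (qd * b'))) a)

set_option maxHeartbeats 8000000 in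
set_option synthInstance.maxHeartbeats 400000 in
include hpin in
/-- ★★ **THE MEMBER ON `D(b)` PRESENTED BY SECTIONS.** Hypotheses of ✓`exists_principalCentreChartSec_of_memberAway` (without the Veronese degree) plus a homogeneous
unit `u` of the localised model with `θ₀ = e₀ • θ_u`, `θ₁ = e₁ • θ_u`. Conclusion: sections `a, b ∈ Γ(D(b))` with `a·u^{e₀} = x′₀/1`, `b·u^{e₁} = φ/1` in the localised
model, a Veronese degree `d₀ > 0`, and for every `l > 0` a principal-centre chart structure of degree `d₀·l` on `D(b)` whose filtration on every affine `U ≤ D(b)` is the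
weighted filtration of `(a|U : 2, b|U : 1)`. [OURS · L1 W4.5c · R4c brick (b3′); NOT a statement of the manuscript] -/
theorem exists_memberSections_away₂
    (P₁ P₂ φ T H Q₁ Q₂ HU R : (MvPolynomial (Option (Fin 4)) k)) (δ : ℕ)
    (hs : letI := DW.instCommRing; letI := DW.instGradedRing; conj Φ DW.σ ((algebraMap (MvPolynomial (Option (Fin 4)) k) (Localization.Away qd)) (X none)) = (algebraMap (MvPolynomial (Option (Fin 4)) k) (Localization.Away qd)) (X none)) (h0 : letI := DW.instCommRing; letI := DW.instGradedRing; conj Φ DW.σ ((algebraMap (MvPolynomial (Option (Fin 4)) k) (Localization.Away qd)) (X (some 0))) = (algebraMap (MvPolynomial (Option (Fin 4)) k) (Localization.Away qd)) (X (some 0)))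
    (h1 : letI := DW.instCommRing; letI := DW.instGradedRing; conj Φ DW.σ ((algebraMap (MvPolynomial (Option (Fin 4)) k) (Localization.Away qd)) P₁) = (algebraMap (MvPolynomial (Option (Fin 4)) k) (Localization.Away qd)) (P₁ + Q₁ * (X none ^ δ * X (some 0))))
    (h2 : letI := DW.instCommRing; letI := DW.instGradedRing; conj Φ DW.σ ((algebraMap (MvPolynomial (Option (Fin 4)) k) (Localization.Away qd)) P₂) = (algebraMap (MvPolynomial (Option (Fin 4)) k) (Localization.Away qd)) (P₂ + Q₂ * (X none ^ δ * X (some 0))))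
    (h3 : letI := DW.instCommRing; letI := DW.instGradedRing; conj Φ DW.σ ((algebraMap (MvPolynomial (Option (Fin 4)) k) (Localization.Away qd)) (X (some 3))) = (algebraMap (MvPolynomial (Option (Fin 4)) k) (Localization.Away qd)) (X (some 3) + X none ^ δ * T))
    (hφ : letI := DW.instCommRing; letI := DW.instGradedRing; conj Φ DW.σ ((algebraMap (MvPolynomial (Option (Fin 4)) k) (Localization.Away qd)) φ) = (algebraMap (MvPolynomial (Option (Fin 4)) k) (Localization.Away qd)) (φ + X none ^ δ * X (some 0) * HU + (X none ^ δ * X (some 0)) ^ 2 * R))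
    (hC : letI := DW.instCommRing; letI := DW.instGradedRing; ∀ a : k, conj Φ DW.σ ((algebraMap (MvPolynomial (Option (Fin 4)) k) (Localization.Away qd)) (C a)) = (algebraMap (MvPolynomial (Option (Fin 4)) k) (Localization.Away qd)) (C a))
    (hq : letI := DW.instCommRing; letI := DW.instGradedRing; conj Φ DW.σ ((algebraMap (MvPolynomial (Option (Fin 4)) k) (Localization.Away qd)) (qd * b')) = (algebraMap (MvPolynomial (Option (Fin 4)) k) (Localization.Away qd)) (qd * b'))
    (hXR : T = H * φ) (hQ₁ : IsUnit ((algebraMap (MvPolynomial (Option (Fin 4)) k) (Localization.Away (qd * b'))) Q₁)) (hHU : IsUnit ((algebraMap (MvPolynomial (Option (Fin 4)) k) (Localization.Away (qd * b'))) HU)) (hH : IsUnit ((algebraMap (MvPolynomial (Option (Fin 4)) k) (Localization.Away (qd * b'))) H))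
    (hgen : Subring.closure (({(algebraMap (MvPolynomial (Option (Fin 4)) k) (Localization.Away (qd * b'))) (X none), (algebraMap (MvPolynomial (Option (Fin 4)) k) (Localization.Away (qd * b'))) (X (some 0)), (algebraMap (MvPolynomial (Option (Fin 4)) k) (Localization.Away (qd * b'))) P₁, (algebraMap (MvPolynomial (Option (Fin 4)) k) (Localization.Away (qd * b'))) P₂, (algebraMap (MvPolynomial (Option (Fin 4)) k) (Localization.Away (qd * b'))) (X (some 3))} : Set (Localization.Away (qd * b'))) ∪ (({IsLocalization.Away.invSelf (qd * b')} : Set (Localization.Away (qd * b'))) ∪ Set.range (algebraMap k (Localization.Away (qd * b'))))) = ⊤)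
    (hK1 : RingTheory.Sequence.IsRegular (Localization.Away (qd * b')) (List.ofFn (![(algebraMap (MvPolynomial (Option (Fin 4)) k) (Localization.Away (qd * b'))) (X (some 0)), (algebraMap (MvPolynomial (Option (Fin 4)) k) (Localization.Away (qd * b'))) φ] : Fin 2 → Localization.Away (qd * b'))))
    (hK1' : IsRegularRing (Localization.Away (qd * b') ⧸ Ideal.span (Set.range (![(algebraMap (MvPolynomial (Option (Fin 4)) k) (Localization.Away (qd * b'))) (X (some 0)), (algebraMap (MvPolynomial (Option (Fin 4)) k) (Localization.Away (qd * b'))) φ] : Fin 2 → Localization.Away (qd * b')))))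
    (θu₀ θu₁ : Π j : Fin DW.m, ZMod (DW.r j)) (e₀ e₁ : ℕ) (u₀ u₁ : (MvPolynomial (Option (Fin 4)) k)) (hu₀ : IsUnit ((algebraMap (MvPolynomial (Option (Fin 4)) k) (Localization.Away (qd * b'))) u₀)) (hu₁ : IsUnit ((algebraMap (MvPolynomial (Option (Fin 4)) k) (Localization.Away (qd * b'))) u₁))
    (hud₀ : letI := DW.instCommRing; letI := DW.instGradedRing; (algebraMap (MvPolynomial (Option (Fin 4)) k) (Localization.Away qd)) u₀ ∈ mapGrading DW.𝒜 Φ θu₀) (hud₁ : letI := DW.instCommRing; letI := DW.instGradedRing; (algebraMap (MvPolynomial (Option (Fin 4)) k) (Localization.Away qd)) u₁ ∈ mapGrading DW.𝒜 Φ θu₁)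
    (hX₀d : letI := DW.instCommRing; letI := DW.instGradedRing; (algebraMap (MvPolynomial (Option (Fin 4)) k) (Localization.Away qd)) (X (some 0)) ∈ mapGrading DW.𝒜 Φ (e₀ • θu₀)) (hφd : letI := DW.instCommRing; letI := DW.instGradedRing; (algebraMap (MvPolynomial (Option (Fin 4)) k) (Localization.Away qd)) φ ∈ mapGrading DW.𝒜 Φ (e₁ • θu₁)) :
    letI := DW.instCommRing; letI := DW.instGradedRing
    letI := GradedLocalization.locGradedRing DW.𝒜 (DW.e b).2
    letI := mapGradedRing (GradedLocalization.locPiece DW.𝒜 (DW.e b).2) Φ'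
    ∃ (a bb : Γ(M.V, (NodeChartAway.basicOpenStable M.act W DW.affine (NodeData.actO_eq_self_of_fixed hG M W DW b hσb)).1)),
      ((((NodeChartAway.basicOpenNodeEquiv M.act W DW.affine b DW.𝒜 DW.e).trans (zeroRingEquiv (GradedLocalization.locPiece DW.𝒜 (DW.e b).2) Φ')) a : ↥(mapGrading (GradedLocalization.locPiece DW.𝒜 (DW.e b).2) Φ' 0)) : Localization.Away (qd * b')) * (algebraMap (MvPolynomial (Option (Fin 4)) k) (Localization.Away (qd * b'))) u₀ ^ e₀ = (algebraMap (MvPolynomial (Option (Fin 4)) k) (Localization.Away (qd * b'))) (X (some 0)) ∧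
      ((((NodeChartAway.basicOpenNodeEquiv M.act W DW.affine b DW.𝒜 DW.e).trans (zeroRingEquiv (GradedLocalization.locPiece DW.𝒜 (DW.e b).2) Φ')) bb : ↥(mapGrading (GradedLocalization.locPiece DW.𝒜 (DW.e b).2) Φ' 0)) : Localization.Away (qd * b')) * (algebraMap (MvPolynomial (Option (Fin 4)) k) (Localization.Away (qd * b'))) u₁ ^ e₁ = (algebraMap (MvPolynomial (Option (Fin 4)) k) (Localization.Away (qd * b'))) φ ∧
      ∃ d₀ : ℕ, 0 < d₀ ∧ ∀ l : ℕ, 0 < l → ∃ 𝒦₀ : ReesFiltration M.V, IsPrincipalCentreChart p M.act g₀ 𝒦₀ (d₀ * l) (NodeChartAway.basicOpenStable M.act W DW.affine (NodeData.actO_eq_self_of_fixed hG M W DW b hσb)) ∧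
        ∀ (U : M.V.affineOpens) (hU : U.1 ≤ (NodeChartAway.basicOpenStable M.act W DW.affine (NodeData.actO_eq_self_of_fixed hG M W DW b hσb)).1) (n : ℕ), (𝒦₀.filtration U).ideal n =
          (weightedFiltration (fun l' => (M.V.presheaf.map (homOfLE hU).op).hom ((![a, bb] : Fin 2 → Γ(M.V, (NodeChartAway.basicOpenStable M.act W DW.affine (NodeData.actO_eq_self_of_fixed hG M W DW b hσb)).1)) l')) ![2, 1]).ideal n := by
  letI := DW.instCommRing
  letI := DW.instGradedRing
  letI instL := GradedLocalization.locGradedRing DW.𝒜 (DW.e b).2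
  letI instP := mapGradedRing (GradedLocalization.locPiece DW.𝒜 (DW.e b).2) Φ'
  -- transferred degrees and the Veronese degree
  have hud₀' := algebraMap_mem_mapGrading_away qd b' Φ ((DW.e b : ↥(DW.𝒜 0)) : DW.B) Φ' hpin DW.𝒜 (DW.e b).2 u₀ hud₀
  have hud₁' := algebraMap_mem_mapGrading_away qd b' Φ ((DW.e b : ↥(DW.𝒜 0)) : DW.B) Φ' hpin DW.𝒜 (DW.e b).2 u₁ hud₁
  have hX₀d' := algebraMap_mem_mapGrading_away qd b' Φ ((DW.e b : ↥(DW.𝒜 0)) : DW.B) Φ' hpin DW.𝒜 (DW.e b).2 (X (some 0)) hX₀d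
  have hφd' := algebraMap_mem_mapGrading_away qd b' Φ ((DW.e b : ↥(DW.𝒜 0)) : DW.B) Φ' hpin DW.𝒜 (DW.e b).2 φ hφd
  obtain ⟨d₀, hver⟩ := exists_veroneseNormalised_memberAway M W DW qd b' Φ b hσb Φ' hpin φ (e₀ • θu₀) (e₁ • θu₁) hX₀d hφd ![2, 1]
  -- degree-0 associates
  obtain ⟨ι₀, hι₀d, hι₀, hι₀u⟩ := CoarseChart.exists_inv_pow_mem_of_isUnit (mapGrading (GradedLocalization.locPiece DW.𝒜 (DW.e b).2) Φ') hud₀' hu₀ e₀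
  obtain ⟨ι₁, hι₁d, hι₁, hι₁u⟩ := CoarseChart.exists_inv_pow_mem_of_isUnit (mapGrading (GradedLocalization.locPiece DW.𝒜 (DW.e b).2) Φ') hud₁' hu₁ e₁
  have ha0 : (algebraMap (MvPolynomial (Option (Fin 4)) k) (Localization.Away (qd * b'))) (X (some 0)) * ι₀ ∈ mapGrading (GradedLocalization.locPiece DW.𝒜 (DW.e b).2) Φ' 0 := by
    have h := SetLike.mul_mem_graded hX₀d' hι₀d
    rwa [add_neg_cancel] at h
  have hb0 : (algebraMap (MvPolynomial (Option (Fin 4)) k) (Localization.Away (qd * b'))) φ * ι₁ ∈ mapGrading (GradedLocalization.locPiece DW.𝒜 (DW.e b).2) Φ' 0 := by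
    have h := SetLike.mul_mem_graded hφd' hι₁d
    rwa [add_neg_cancel] at h
  obtain ⟨a, ha⟩ : ∃ a : Γ(M.V, (NodeChartAway.basicOpenStable M.act W DW.affine (NodeData.actO_eq_self_of_fixed hG M W DW b hσb)).1), a = ((NodeChartAway.basicOpenNodeEquiv M.act W DW.affine b DW.𝒜 DW.e).trans (zeroRingEquiv (GradedLocalization.locPiece DW.𝒜 (DW.e b).2) Φ')).symm ⟨_, ha0⟩ := ⟨_, rfl⟩
  obtain ⟨bb, hbb⟩ : ∃ bb : Γ(M.V, (NodeChartAway.basicOpenStable M.act W DW.affine (NodeData.actO_eq_self_of_fixed hG M W DW b hσb)).1), bb = ((NodeChartAway.basicOpenNodeEquiv M.act W DW.affine b DW.𝒜 DW.e).trans (zeroRingEquiv (GradedLocalization.locPiece DW.𝒜 (DW.e b).2) Φ')).symm ⟨_, hb0⟩ := ⟨_, rfl⟩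
  have hea : ((((NodeChartAway.basicOpenNodeEquiv M.act W DW.affine b DW.𝒜 DW.e).trans (zeroRingEquiv (GradedLocalization.locPiece DW.𝒜 (DW.e b).2) Φ')) a : ↥(mapGrading (GradedLocalization.locPiece DW.𝒜 (DW.e b).2) Φ' 0)) : Localization.Away (qd * b')) = (algebraMap (MvPolynomial (Option (Fin 4)) k) (Localization.Away (qd * b'))) (X (some 0)) * ι₀ := by rw [ha, RingEquiv.apply_symm_apply]
  have heb : ((((NodeChartAway.basicOpenNodeEquiv M.act W DW.affine b DW.𝒜 DW.e).trans (zeroRingEquiv (GradedLocalization.locPiece DW.𝒜 (DW.e b).2) Φ')) bb : ↥(mapGrading (GradedLocalization.locPiece DW.𝒜 (DW.e b).2) Φ' 0)) : Localization.Away (qd * b')) = (algebraMap (MvPolynomial (Option (Fin 4)) k) (Localization.Away (qd * b'))) φ * ι₁ := by rw [hbb, RingEquiv.apply_symm_apply]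
  refine ⟨a, bb, ?_, ?_, d₀, hver.1, fun l hl => ?_⟩
  · change ((((NodeChartAway.basicOpenNodeEquiv M.act W DW.affine b DW.𝒜 DW.e).trans (zeroRingEquiv (GradedLocalization.locPiece DW.𝒜 (DW.e b).2) Φ')) a : ↥(mapGrading (GradedLocalization.locPiece DW.𝒜 (DW.e b).2) Φ' 0)) : Localization.Away (qd * b')) * (algebraMap (MvPolynomial (Option (Fin 4)) k) (Localization.Away (qd * b'))) u₀ ^ e₀ = (algebraMap (MvPolynomial (Option (Fin 4)) k) (Localization.Away (qd * b'))) (X (some 0))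
    rw [hea, mul_assoc, mul_comm ι₀, hι₀, mul_one]
  · change ((((NodeChartAway.basicOpenNodeEquiv M.act W DW.affine b DW.𝒜 DW.e).trans (zeroRingEquiv (GradedLocalization.locPiece DW.𝒜 (DW.e b).2) Φ')) bb : ↥(mapGrading (GradedLocalization.locPiece DW.𝒜 (DW.e b).2) Φ' 0)) : Localization.Away (qd * b')) * (algebraMap (MvPolynomial (Option (Fin 4)) k) (Localization.Away (qd * b'))) u₁ ^ e₁ = (algebraMap (MvPolynomial (Option (Fin 4)) k) (Localization.Away (qd * b'))) φ
    rw [heb, mul_assoc, mul_comm ι₁, hι₁, mul_one]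
  obtain ⟨𝒦₀, hprin, -, hres⟩ := exists_principalCentreChartSec_of_memberAway hG M W DW qd b' Φ b hσb Φ' hpin P₁ P₂ φ T H Q₁ Q₂ HU R δ
    hs h0 h1 h2 h3 hφ hC hq hXR hQ₁ hHU hH hgen hK1 hK1' (e₀ • θu₀) (e₁ • θu₁) hX₀d hφd (d₀ * l) (CoarseChart.veroneseNormalised_mul _ _ _ hver hl)
  refine ⟨𝒦₀, hprin, fun U hU n => ?_⟩
  rw [CoarseChart.filtration_eq_weightedFiltration_sections 𝒦₀ (NodeChartAway.basicOpenStable M.act W DW.affine (NodeData.actO_eq_self_of_fixed hG M W DW b hσb)).1 (mapGrading (GradedLocalization.locPiece DW.𝒜 (DW.e b).2) Φ') ((NodeChartAway.basicOpenNodeEquiv M.act W DW.affine b DW.𝒜 DW.e).trans (zeroRingEquiv (GradedLocalization.locPiece DW.𝒜 (DW.e b).2) Φ')) (![(algebraMap (MvPolynomial (Option (Fin 4)) k) (Localization.Away (qd * b'))) (X (some 0)), (algebraMap (MvPolynomial (Option (Fin 4)) k) (Localization.Away (qd * b'))) φ] : Fin 2 → Localization.Away (qd * b')) ![2, 1] hres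 ![a, bb] ?_ U hU n]
  intro i
  fin_cases i
  · change Associated ((algebraMap (MvPolynomial (Option (Fin 4)) k) (Localization.Away (qd * b'))) (X (some 0))) (((((NodeChartAway.basicOpenNodeEquiv M.act W DW.affine b DW.𝒜 DW.e).trans (zeroRingEquiv (GradedLocalization.locPiece DW.𝒜 (DW.e b).2) Φ')) a : ↥(mapGrading (GradedLocalization.locPiece DW.𝒜 (DW.e b).2) Φ' 0)) : Localization.Away (qd * b')))
    rw [hea]
    exact associated_mul_unit_right _ _ hι₀u
  · change Associated ((algebraMap (MvPolynomial (Option (Fin 4)) k) (Localization.Away (qd * b'))) φ) (((((NodeChartAway.basicOpenNodeEquiv M.act W DW.affine b DW.𝒜 DW.e).trans (zeroRingEquiv (GradedLocalization.locPiece DW.𝒜 (DW.e b).2) Φ')) bb : ↥(mapGrading (GradedLocalization.locPiece DW.𝒜 (DW.e b).2) Φ' 0)) : Localization.Away (qd * b')))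
    rw [heb]
    exact associated_mul_unit_right _ _ hι₁u

end MemberAway

end Summit.ResolutionOfSingularities.ResolutionOfSingularities.Theorems.WildQuotientResolution.S1.GameFrame.GModel

end
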